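import Literature.NumberTheory.Automorphic.PadicIntermediateFieldUnitBall
import Literature.RingTheory.DiscreteValuationRing.QuotientSelfInjective
import Mathlib.FieldTheory.IntermediateField.Adjoin.Basic
import HarnessLib

/-!
# The tower `𝒪_{E₀} ⊂ 𝒪_{E} ⊂ ℤ̄_p`: inclusions, purity, split injections modulo `p^t`,
# finite enlargements

Topic `NumberTheory/Automorphic`; namespace
`Literature.NumberTheory.Automorphic.PadicIntermediateField`.  Definitions with bodies, instances
and theorems; no named fact, no `sorry`.

For finite `E₀ ≤ E` inside `ℚ̄_p` with unit balls `𝒪_{E₀} = unitBall p E₀ ⊆ 𝒪_E ⊆ ℤ̄_p`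
(`ℤ̄_p = (PadicAlgCl.valued p).v.valuationSubring`):

* `toValuationSubring : 𝒪_E →+* ℤ̄_p` and the `Algebra 𝒪_E ℤ̄_p` instance; the scalar towers;
* **purity** `dvd_of_dvd_valuationSubring`: `p^t ∣ x` in `ℤ̄_p` implies `p^t ∣ x` in `𝒪_E`;
* **`𝒪_E/p^t ↪ ℤ̄_p/p^t` splits `𝒪_E`-linearly** (`exists_retraction_mod_pow`), from the
  self-injectivity of `𝒪_E/p^t` (`RingTheory/DiscreteValuationRing/QuotientSelfInjective`);
* **finite enlargement** `exists_finite_ge_mem`: every `a ∈ ℤ̄_p` lies in `𝒪_{E₁}` for a finite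
  `E₁ ⊇ E₀` (`E₁ = E₀ ⊔ ℚ_p(a)`, `a` being algebraic over `ℚ_p`).

Use: the passage `𝒪_{E₀} → ℤ̄_p` for Hecke eigenclasses and their annihilators in
[Scholze2015, §V.4].

## References

* J. Neukirch, *Algebraic Number Theory* (1999), Ch. II §6. [NeukirchANT1999]
* T. Y. Lam, *Lectures on Modules and Rings*, GTM 189 (1999), §3B. [Lam1999]
* P. Scholze, Ann. of Math. 182 (2015), §V.4. [Scholze2015]
-/

noncomputable section

namespace Literature.NumberTheory.Automorphic

namespace PadicIntermediateField

open IntermediateField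

variable (p : ℕ) [Fact p.Prime] (E : IntermediateField ℚ_[p] (PadicAlgCl p))

/-! ### `𝒪_E → ℤ̄_p` -/

/-- **The inclusion `𝒪_E →+* ℤ̄_p`.** [folklore] -/
def toValuationSubring : unitBall p E →+* (PadicAlgCl.valued p).v.valuationSubring where
  toFun x := ⟨x, (Valuation.mem_valuationSubring_iff _ _).2 (valued_le_one_of_mem_unitBall p E x.2)⟩
  map_one' := rfl
  map_mul' _ _ := rfl
  map_zero' := rfl
  map_add' _ _ := rfl

/-- Unfolding lemma. [folklore] -/
@[simp]
theorem coe_toValuationSubring (x : unitBall p E) :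
    ((toValuationSubring p E x : (PadicAlgCl.valued p).v.valuationSubring) : PadicAlgCl p) = x :=
  rfl

/-- `toValuationSubring` is injective. [folklore] -/
theorem toValuationSubring_injective : Function.Injective (toValuationSubring p E) :=
  fun _ _ h => Subtype.ext (congrArg (fun z : (PadicAlgCl.valued p).v.valuationSubring =>
    (z : PadicAlgCl p)) h)

/-- **`ℤ̄_p` as an `𝒪_E`-algebra.** [folklore] -/
instance algebraValuationSubring : Algebra (unitBall p E) (PadicAlgCl.valued p).v.valuationSubring :=
  (toValuationSubring p E).toAlgebra

/-- Unfolding lemma for the algebra map. [folklore] -/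
theorem algebraMap_valuationSubring_apply (x : unitBall p E) :
    algebraMap (unitBall p E) (PadicAlgCl.valued p).v.valuationSubring x = toValuationSubring p E x :=
  rfl

/-- `𝒪_E → ℤ̄_p → ℚ̄_p` is a scalar tower. [folklore] -/
instance isScalarTower_valuationSubring_padicAlgCl :
    IsScalarTower (unitBall p E) (PadicAlgCl.valued p).v.valuationSubring (PadicAlgCl p) :=
  IsScalarTower.of_algebraMap_eq fun _ => rfl

/-- `(p : 𝒪_E) ↦ (p : ℤ̄_p)`, with powers. [folklore] -/
theorem toValuationSubring_natCast_pow (t : ℕ) :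
    toValuationSubring p E (((p : ℕ) : unitBall p E) ^ t) =
      ((p : ℕ) : (PadicAlgCl.valued p).v.valuationSubring) ^ t := by
  rw [map_pow, map_natCast]

/-! ### Purity and the split injection modulo `p^t` -/

/-- **Purity**: if `p^t` divides `x ∈ 𝒪_E` in `ℤ̄_p`, it divides `x` in `𝒪_E`. [folklore] -/
theorem dvd_of_dvd_valuationSubring (t : ℕ) (x : unitBall p E)
    (h : ∃ y : (PadicAlgCl.valued p).v.valuationSubring,
      toValuationSubring p E x = y * toValuationSubring p E (((p : ℕ) : unitBall p E) ^ t)) :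
    ((p : ℕ) : unitBall p E) ^ t ∣ x := by
  obtain ⟨y, hy⟩ := h
  refine pow_prime_dvd_of_dvd_valuationSubring p E t ⟨y, (Valuation.mem_valuationSubring_iff _ _).1 y.2, ?_⟩
  have h' := congrArg (fun z : (PadicAlgCl.valued p).v.valuationSubring => (z : PadicAlgCl p)) hy
  simpa using h'

/-- **`𝒪_E/p^t ↪ ℤ̄_p/p^t` admits an `𝒪_E`-linear retraction** (for `E` finite over `ℚ_p`, so
that `𝒪_E` is a principal ideal domain and `𝒪_E/p^t` is self-injective).
[cite: Lam1999, §3B (3.13)] -/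
theorem exists_retraction_mod_pow [FiniteDimensional ℚ_[p] E] (t : ℕ) :
    ∃ r : ((PadicAlgCl.valued p).v.valuationSubring ⧸ Ideal.span
        ({algebraMap (unitBall p E) (PadicAlgCl.valued p).v.valuationSubring
          (((p : ℕ) : unitBall p E) ^ t)} : Set _)) →ₗ[unitBall p E]
        (unitBall p E ⧸ Ideal.span ({((p : ℕ) : unitBall p E) ^ t} : Set _)),
      ∀ x : unitBall p E, r (Ideal.Quotient.mk _
        (algebraMap (unitBall p E) (PadicAlgCl.valued p).v.valuationSubring x)) =
          Ideal.Quotient.mk _ x := by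
  haveI : IsPrincipalIdealRing (unitBall p E) := isPrincipalIdealRing_unitBall p E
  refine Literature.RingTheory.DiscreteValuationRing.exists_retraction_quotient_algebraMap
    (pow_ne_zero t (natCast_prime_ne_zero p E)) _ fun x hx => ?_
  exact dvd_of_dvd_valuationSubring p E t x hx

/-! ### Two unit balls `𝒪_{E₀} ⊆ 𝒪_E` -/

section Tower

variable (E₀ : IntermediateField ℚ_[p] (PadicAlgCl p)) (hle : E₀ ≤ E)

/-- With the algebra structure `𝒪_{E₀} → 𝒪_E` of `unitBall_mono`, `𝒪_{E₀} → 𝒪_E → ℤ̄_p` is a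
scalar tower. [folklore] -/
theorem isScalarTower_unitBall_valuationSubring :
    letI := (Subring.inclusion (unitBall_mono p E E₀ hle)).toAlgebra
    IsScalarTower (unitBall p E₀) (unitBall p E) (PadicAlgCl.valued p).v.valuationSubring := by
  letI := (Subring.inclusion (unitBall_mono p E E₀ hle)).toAlgebra
  exact IsScalarTower.of_algebraMap_eq fun _ => rfl

/-- … and so is `𝒪_{E₀} → 𝒪_E → ℚ̄_p`. [folklore] -/
theorem isScalarTower_unitBall_padicAlgCl :
    letI := (Subring.inclusion (unitBall_mono p E E₀ hle)).toAlgebra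
    IsScalarTower (unitBall p E₀) (unitBall p E) (PadicAlgCl p) := by
  letI := (Subring.inclusion (unitBall_mono p E E₀ hle)).toAlgebra
  exact IsScalarTower.of_algebraMap_eq fun _ => rfl

/-- The algebra map `𝒪_{E₀} → 𝒪_E` on `p^t`. [folklore] -/
theorem algebraMap_unitBall_natCast_pow (t : ℕ) :
    letI := (Subring.inclusion (unitBall_mono p E E₀ hle)).toAlgebra
    algebraMap (unitBall p E₀) (unitBall p E) (((p : ℕ) : unitBall p E₀) ^ t) =
      ((p : ℕ) : unitBall p E) ^ t := by
  letI := (Subring.inclusion (unitBall_mono p E E₀ hle)).toAlgebra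
  rw [map_pow, map_natCast]

end Tower

/-! ### Finite enlargements -/

/-- **Every `a ∈ ℤ̄_p` lies in `𝒪_{E₁}` for some finite `E₁ ⊇ E₀`** (`E₁ = E₀(a)`; `a` is
algebraic over `ℚ_p`). [folklore] -/
theorem exists_finite_ge_mem (E₀ : IntermediateField ℚ_[p] (PadicAlgCl p))
    [FiniteDimensional ℚ_[p] E₀] (a : (PadicAlgCl.valued p).v.valuationSubring) :
    ∃ E₁ : IntermediateField ℚ_[p] (PadicAlgCl p), FiniteDimensional ℚ_[p] E₁ ∧ E₀ ≤ E₁ ∧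
      (a : PadicAlgCl p) ∈ unitBall p E₁ := by
  have ha : IsIntegral ℚ_[p] (a : PadicAlgCl p) := Algebra.IsIntegral.isIntegral _
  haveI : FiniteDimensional ℚ_[p] ℚ_[p]⟮(a : PadicAlgCl p)⟯ :=
    IntermediateField.adjoin.finiteDimensional ha
  refine ⟨E₀ ⊔ ℚ_[p]⟮(a : PadicAlgCl p)⟯, inferInstance, le_sup_left, ?_⟩
  rw [mem_unitBall_iff]
  exact ⟨(le_sup_right : ℚ_[p]⟮(a : PadicAlgCl p)⟯ ≤ E₀ ⊔ ℚ_[p]⟮(a : PadicAlgCl p)⟯)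
    (IntermediateField.mem_adjoin_simple_self ℚ_[p] (a : PadicAlgCl p)),
    (Valuation.mem_valuationSubring_iff _ _).1 a.2⟩

end PadicIntermediateField

end Literature.NumberTheory.Automorphic
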